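import Summits.QuantumFields.YangMills.Theorems.BalabanUVNodesN19BillFlag

/-!
# BalabanUVNodes ∕ node N19 (NE7) — THE DEVIATION FLAG IS CANONICAL: at FIXED shells, weights `W` and radius `δ`, SOME bad class gives the hybrid binder list
# `HybridNE7 l₀ vol T A B Bad W shA shB Wsh δ` IF AND ONLY IF per step ONE centre `c_K` exists whose sandwich-VIOLATORS (the classes whose shell-subtracted cores deviate from
# `e^{c_K}` by more than `e^{±vol·δ_K}`) carry relative weight `≤ W_K` in BOTH runs — the N19′ ∧ N20 pair is ONE two-run TAIL-MASS letter on the log-ratio deviation; the violator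
# flag is optimal; mean ∕ moment ∕ exponential-moment letters (p623522, p626380) are its prices

Cell `pub-ymgap` (HUMAN RULING D-0062 Track A ∕ D-0149 width seats), WIDTH SEAT `pub-ymgap-dag-n19-w1` (node n19 = NE7, seat 1 of 3), generation g5, CLAIM-6 ∕ INTENT-6.  Route
`Summits/QuantumFields/YangMills/Theses/BalabanUVNodes.lean`, key item K3⁸ `SpineGivenEndpointR13SepCoPHV` (stmt-QuantumFields-27366, KEY MAP v2; (δⱽ) display of K3⁷
stmt-QuantumFields-20544; stub 2 `stub_expansion13HV`: `∃ jc sh cr, PinnedAtLive jc sh cr ∧ KeyedRelWeight cr ∧ KeyedShellWeight cr ∧ KeyedExtractionV cr ∧ KeyedCoreEdgeHolderD4V β cr …`);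
filed `--kind proof --supports … --as helper`.  COUNT-NEUTRAL.  THEOREMS ONLY (0 `def`, 0 `sorry`).  ADDITIVE — imports this seat's g5 `…Theorems.BalabanUVNodesN19BillFlag` (p623522;
through it the tree's `Spine/NE7/Targets` (`Core`), `T4MatchingAssembly` (`HybridNE7`, `hybridNE7_of_relWeightBound`, `shellWeightBound_zero`), `T4WeightBudget` (`RelWeightBound`),
`T4IndicatorShell` (`ShellWeightBound`)) ONLY; modifies nothing.

WHY.  p623522 ∕ p626380 price the bill flag by letters (mean, moments, exponential moments) and FILE 5 shows the price is real.  Underneath sits a cleaner fact that the plan can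
quote when it cuts the re-keyed stub: at fixed shells, weights and radius the bad class is NOT a free design choice — the binder list exists for SOME bad class iff it holds for the
VIOLATOR flag of some centre, and that is a single two-run letter.  THIS FILE proves it in the tree's shapes.
* §1 [folklore] `sandwich_of_not_mem_devFlag` (off the violator flag the sandwich holds) · `devFlag_subset_of_core` (any flag carrying the `core` clause with centre `c` CONTAINS the
  violator flag of `c`).
* §2 [folklore] ★★★ `exists_bad_hybridNE7_iff` — `A, B ≥ 0`, `ShellWeightBound … shA shB Wsh` ⇒ (`∃ Bad, HybridNE7 l₀ vol T A B Bad W shA shB Wsh δ`) ↔ (`0 ≤ W`, `W + Wsh < 1`,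
  `Σ W < ∞`, `Σ δ < ∞`, and `∀ K ∃ c ∀ |t| ≤ l₀`: the violators of the `(c, vol·δ_K)` sandwich of the shell-subtracted cores have `A`-mass `≤ W_K·Σ A` and `B`-mass `≤ W_K·Σ B`) ·
  ★★ `exists_bad_hybridNE7_zeroShell_iff` (the zero-shell edition: violators of `e^{c ∓ vol·δ_K}·A ≤ B ≤ …`).
* §3 [folklore] ★ `hybridNE7_devFlag_of_hybridNE7` — OPTIMALITY: any binder list's weights ∕ shells ∕ radius also serve the violator flag of its own centres.
* §4 [folklore] ★★ `exists_sourceIndepBad_hybridNE7_iff` — the same exact criterion for a SOURCE-INDEPENDENT bad class `Bad : ℕ → Finset ι` (the record's bad-key readings ignore the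
  source): the canonical flag is «violator at SOME admissible source», and the letter is its relative mass at EVERY admissible source.
READINGS (located; nothing proposed).  (i) For a v6∕v7 text of stub 2: once `sh` is pinned (zero or the shell split of record), the conjuncts `KeyedRelWeight cr ∧ KeyedCoreEdgeHolderD4V β cr …`
with a free bad-key reading are equivalent to ONE letter — «per step one constant; the two-run log-ratio deviation of the (shell-subtracted) coarse class weights beyond `vol·δ_K`
carries relative mass `≤ W_K` in both runs, `W`, `δ` summable» — so a bad-key reading typed in advance (persistence, size, count, bill threshold) is a CHOICE OF PRICE, never a loss of
generality only if it contains the violators.  (ii) The letter is a TAIL bound; p623522 §2 (Markov), p626380 §1∕§3 (moments ∕ Chernoff) are the ways to pay it from integrated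
letters, FILE 5 the proof that the first-moment price carries a root.  (iii) Nothing here is Bałaban's; the letter for the d = 4 densities is unprinted and unproved.

HONEST FRAMING.  Finite-sum bookkeeping [folklore] over the tree's SHAPES (`Core`, `RelWeightBound`, `ShellWeightBound`, `HybridNE7`); weights, shells, radii, centres occur as
HYPOTHESES ∕ witnesses only; nothing of Bałaban's is asserted or instantiated; no estimate of the programme is proved.  NE7 ∕ NE7b ∕ NE7c NOT PRINTED as two-run statements for d = 4
∕ NOT proved; N19 ∕ N20 ∕ N21 NOT discharged; K3⁸ OPEN, not claimed, «v6» untouched; counts UNMOVED (typed 28∕28 · discharged 5∕27, A 5∕28).  Everything below is PROVED (0 `sorry`,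
0 named facts, standard axioms); no decl carries a cite tag.  One finite four-torus programme at fixed ε — NOT ℝ⁴, NOT infinite volume, NOT OS, NOT a mass gap, NOT the Clay problem
(R4 closes the conditional finite-𝕋⁴ rung `BalabanLadder.UV` only).
-/

noncomputable section

open Finset
open scoped BigOperators

namespace Summit.QuantumFields.YangMills.BalabanUVNodes.N19DeviationFlagCanonical

open Summit.QuantumFields.BalabanUV.T4Continuum.Spine.NE7 (Core)
open Literature.MathematicalPhysics.QuantumFieldTheory.Balaban1983to89
open T4WeightBudget (RelWeightBound)
open T4IndicatorShell (ShellWeightBound)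
open T4MatchingAssembly (HybridNE7 hybridNE7_of_relWeightBound)

variable {ι : Type*} [DecidableEq ι] {l₀ vol : ℝ} {T : ℕ → Finset ι} {A B shA shB : ℕ → ℝ → ι → ℝ} {W Wsh δ : ℕ → ℝ}

/-! ## §1 The deviation flag of a centre `c` and a radius: the classes whose shell-subtracted cores VIOLATE the sandwich [folklore] -/

/-- Off the deviation flag the sandwich holds (by definition; classical). [folklore] -/
theorem sandwich_of_not_mem_devFlag {K : ℕ} {t c : ℝ} {τ : ι}
    (hτ : τ ∈ T K \ (T K).filter fun τ => ¬ (Real.exp (c - vol * δ K) * (A K t τ - shA K t τ) ≤ B K t τ - shB K t τ ∧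
        B K t τ - shB K t τ ≤ Real.exp (c + vol * δ K) * (A K t τ - shA K t τ))) :
    Real.exp (c - vol * δ K) * (A K t τ - shA K t τ) ≤ B K t τ - shB K t τ ∧ B K t τ - shB K t τ ≤ Real.exp (c + vol * δ K) * (A K t τ - shA K t τ) := by
  rw [Finset.mem_sdiff, Finset.mem_filter, not_and, not_not] at hτ
  exact hτ.2 hτ.1

/-- Under ANY flag carrying the `core` clause with centre `c`, the deviation flag of `c` is CONTAINED in it: a violator cannot be a kept class. [folklore] -/
theorem devFlag_subset_of_core {Bad : ℕ → ℝ → Finset ι} {K : ℕ} {c : ℝ}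
    (hc : ∀ t : ℝ, |t| ≤ l₀ → ∀ τ ∈ T K \ Bad K t,
      Real.exp (c - vol * δ K) * (A K t τ - shA K t τ) ≤ B K t τ - shB K t τ ∧ B K t τ - shB K t τ ≤ Real.exp (c + vol * δ K) * (A K t τ - shA K t τ))
    {t : ℝ} (ht : |t| ≤ l₀) :
    ((T K).filter fun τ => ¬ (Real.exp (c - vol * δ K) * (A K t τ - shA K t τ) ≤ B K t τ - shB K t τ ∧
        B K t τ - shB K t τ ≤ Real.exp (c + vol * δ K) * (A K t τ - shA K t τ))) ⊆ Bad K t := by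
  intro τ hτ
  obtain ⟨hT, hviol⟩ := Finset.mem_filter.mp hτ
  by_contra hB
  exact hviol (hc t ht τ (Finset.mem_sdiff.mpr ⟨hT, hB⟩))

/-! ## §2 THE DEVIATION FLAG IS CANONICAL: the exact criterion for the binder list at fixed shells, weights and radius [folklore] -/

/-- **★★★ THE EXACT CRITERION** [folklore].  Fix the carriers, the two runs' class weights `A, B ≥ 0`, a shell split with `ShellWeightBound … shA shB Wsh`, weights `W` and a radius
`δ`.  Then SOME bad class `Bad` (source-dependent allowed) gives the binder list `HybridNE7 l₀ vol T A B Bad W shA shB Wsh δ` IF AND ONLY IF: `0 ≤ W_K`, `W_K + Wsh_K < 1`, `Σ W < ∞`,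
`Σ δ < ∞`, and per step ONE centre `c_K` such that at every admissible source the classes whose shell-subtracted cores VIOLATE the sandwich `e^{c_K ∓ vol·δ_K}` carry relative weight
`≤ W_K` in BOTH runs.  (⇒: violators lie in any admissible `Bad`; ⇐: flag exactly the violators.)  So the N19′ ∧ N20 pair of the binder list is ONE two-run letter — a TAIL-MASS bound
for the log-ratio deviation from one constant per step — of which p623522's mean ∕ moment ∕ exponential-moment letters (Markov ∕ Chernoff) are sufficient prices and p626380 §2's
relative bill flag the sandwich-shaped producer. -/
theorem exists_bad_hybridNE7_iff (hA0 : ∀ (K : ℕ) (t : ℝ), |t| ≤ l₀ → ∀ τ ∈ T K, 0 ≤ A K t τ) (hB0 : ∀ (K : ℕ) (t : ℝ), |t| ≤ l₀ → ∀ τ ∈ T K, 0 ≤ B K t τ)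
    (hSh : ShellWeightBound l₀ T A B shA shB Wsh) :
    (∃ Bad : ℕ → ℝ → Finset ι, HybridNE7 l₀ vol T A B Bad W shA shB Wsh δ) ↔
      (∀ K, 0 ≤ W K) ∧ (∀ K, W K + Wsh K < 1) ∧ Summable W ∧ Summable δ ∧
        ∀ K : ℕ, ∃ c : ℝ, ∀ t : ℝ, |t| ≤ l₀ →
          (∑ τ ∈ (T K).filter (fun τ => ¬ (Real.exp (c - vol * δ K) * (A K t τ - shA K t τ) ≤ B K t τ - shB K t τ ∧
              B K t τ - shB K t τ ≤ Real.exp (c + vol * δ K) * (A K t τ - shA K t τ))), A K t τ ≤ W K * ∑ τ ∈ T K, A K t τ) ∧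
          (∑ τ ∈ (T K).filter (fun τ => ¬ (Real.exp (c - vol * δ K) * (A K t τ - shA K t τ) ≤ B K t τ - shB K t τ ∧
              B K t τ - shB K t τ ≤ Real.exp (c + vol * δ K) * (A K t τ - shA K t τ))), B K t τ ≤ W K * ∑ τ ∈ T K, B K t τ) := by
  constructor
  · rintro ⟨Bad, h⟩
    have hW := h.weight
    refine ⟨hW.nonneg, h.lt_one, hW.summable, h.summable, fun K => ?_⟩
    obtain ⟨c, hc⟩ := h.core K
    refine ⟨c, fun t ht => ?_⟩
    have hsub := devFlag_subset_of_core (T := T) (A := A) (B := B) (shA := shA) (shB := shB) (δ := δ) hc ht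
    exact ⟨(Finset.sum_le_sum_of_subset_of_nonneg hsub fun τ hτ _ => hA0 K t ht τ (hW.bad_subset K t ht hτ)).trans (hW.bad_left K t ht),
      (Finset.sum_le_sum_of_subset_of_nonneg hsub fun τ hτ _ => hB0 K t ht τ (hW.bad_subset K t ht hτ)).trans (hW.bad_right K t ht)⟩
  · rintro ⟨hW0, hlt, hWs, hδ, hmass⟩
    choose c hc using hmass
    refine ⟨fun K t => (T K).filter fun τ => ¬ (Real.exp (c K - vol * δ K) * (A K t τ - shA K t τ) ≤ B K t τ - shB K t τ ∧
        B K t τ - shB K t τ ≤ Real.exp (c K + vol * δ K) * (A K t τ - shA K t τ)), ?_⟩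
    have hW : RelWeightBound l₀ T A B (fun K t => (T K).filter fun τ => ¬ (Real.exp (c K - vol * δ K) * (A K t τ - shA K t τ) ≤ B K t τ - shB K t τ ∧
        B K t τ - shB K t τ ≤ Real.exp (c K + vol * δ K) * (A K t τ - shA K t τ))) W :=
      { bad_subset := fun _ _ _ => Finset.filter_subset _ _
        nonneg := hW0
        lt_one := fun K => by linarith [hlt K, hSh.nonneg K]
        summable := hWs
        bad_left := fun K t ht => (hc K t ht).1
        bad_right := fun K t ht => (hc K t ht).2 }
    exact hybridNE7_of_relWeightBound hW hSh hlt hδ fun K => ⟨c K, fun t _ τ hτ => sandwich_of_not_mem_devFlag hτ⟩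

/-- **★★ ZERO SHELLS** [folklore]: with `A, B ≥ 0`, SOME bad class gives `HybridNE7 l₀ vol T A B Bad W 0 0 0 δ` iff `0 ≤ W_K < 1` summable, `Σ δ < ∞`, and per step one centre whose
sandwich-violators — the classes with two-run log-ratio deviation beyond `vol·δ_K` — carry relative weight `≤ W_K` in both runs at every admissible source. -/
theorem exists_bad_hybridNE7_zeroShell_iff (hA0 : ∀ (K : ℕ) (t : ℝ), |t| ≤ l₀ → ∀ τ ∈ T K, 0 ≤ A K t τ)
    (hB0 : ∀ (K : ℕ) (t : ℝ), |t| ≤ l₀ → ∀ τ ∈ T K, 0 ≤ B K t τ) :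
    (∃ Bad : ℕ → ℝ → Finset ι, HybridNE7 l₀ vol T A B Bad W (fun _ _ _ => 0) (fun _ _ _ => 0) (fun _ => 0) δ) ↔
      (∀ K, 0 ≤ W K) ∧ (∀ K, W K < 1) ∧ Summable W ∧ Summable δ ∧
        ∀ K : ℕ, ∃ c : ℝ, ∀ t : ℝ, |t| ≤ l₀ →
          (∑ τ ∈ (T K).filter (fun τ => ¬ (Real.exp (c - vol * δ K) * A K t τ ≤ B K t τ ∧ B K t τ ≤ Real.exp (c + vol * δ K) * A K t τ)), A K t τ ≤
              W K * ∑ τ ∈ T K, A K t τ) ∧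
          (∑ τ ∈ (T K).filter (fun τ => ¬ (Real.exp (c - vol * δ K) * A K t τ ≤ B K t τ ∧ B K t τ ≤ Real.exp (c + vol * δ K) * A K t τ)), B K t τ ≤
              W K * ∑ τ ∈ T K, B K t τ) := by
  have h := exists_bad_hybridNE7_iff (vol := vol) (W := W) (δ := δ) hA0 hB0 (T4MatchingAssembly.shellWeightBound_zero hA0 hB0)
  simp only [sub_zero, add_zero] at h
  exact h

/-! ## §3 Optimality: the deviation flag never pays more than any other flag [folklore] -/

/-- **★ THE DEVIATION FLAG IS OPTIMAL** [folklore]: if some flag `Bad` gives the binder list with weights `W`, shells `sh`, radius `δ`, then the deviation flag of the SAME centres does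
too, with the SAME `W`, `sh`, `δ` — flagging anything beyond the sandwich-violators is never needed. -/
theorem hybridNE7_devFlag_of_hybridNE7 {Bad : ℕ → ℝ → Finset ι}
    (hA0 : ∀ (K : ℕ) (t : ℝ), |t| ≤ l₀ → ∀ τ ∈ T K, 0 ≤ A K t τ) (hB0 : ∀ (K : ℕ) (t : ℝ), |t| ≤ l₀ → ∀ τ ∈ T K, 0 ≤ B K t τ)
    (h : HybridNE7 l₀ vol T A B Bad W shA shB Wsh δ) :
    ∃ c : ℕ → ℝ, HybridNE7 l₀ vol T A B (fun K t => (T K).filter fun τ => ¬ (Real.exp (c K - vol * δ K) * (A K t τ - shA K t τ) ≤ B K t τ - shB K t τ ∧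
        B K t τ - shB K t τ ≤ Real.exp (c K + vol * δ K) * (A K t τ - shA K t τ))) W shA shB Wsh δ := by
  have hW := h.weight
  choose c hc using h.core
  refine ⟨c, hybridNE7_of_relWeightBound ?_ h.shell h.lt_one h.summable fun K => ⟨c K, fun t _ τ hτ => sandwich_of_not_mem_devFlag hτ⟩⟩
  exact
    { bad_subset := fun _ _ _ => Finset.filter_subset _ _
      nonneg := hW.nonneg
      lt_one := hW.lt_one
      summable := hW.summable
      bad_left := fun K t ht =>
        (Finset.sum_le_sum_of_subset_of_nonneg (devFlag_subset_of_core (hc K) ht) fun τ hτ _ => hA0 K t ht τ (hW.bad_subset K t ht hτ)).trans (hW.bad_left K t ht)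
      bad_right := fun K t ht =>
        (Finset.sum_le_sum_of_subset_of_nonneg (devFlag_subset_of_core (hc K) ht) fun τ hτ _ => hB0 K t ht τ (hW.bad_subset K t ht hτ)).trans (hW.bad_right K t ht) }

/-! ## §4 Source-INDEPENDENT bad classes: the violators at SOME admissible source [folklore] -/

section SourceIndependent
open Classical in
/-- **★★ THE EXACT CRITERION FOR A SOURCE-INDEPENDENT BAD CLASS** [folklore] (the record's bad-key readings `bd K u` ignore the source).  With `A, B ≥ 0` and a shell split
`ShellWeightBound … shA shB Wsh`: SOME source-independent bad class `Bad : ℕ → Finset ι` gives `HybridNE7 … (fun K _ => Bad K) W shA shB Wsh δ` IFF `0 ≤ W`, `W + Wsh < 1`, `Σ W < ∞`,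
`Σ δ < ∞` and per step ONE centre `c_K` such that the classes violating the `(c_K, vol·δ_K)` sandwich AT SOME admissible source carry, at EVERY admissible source, relative weight
`≤ W_K` in both runs.  (The union-of-violators flag is the canonical source-independent flag.) -/
theorem exists_sourceIndepBad_hybridNE7_iff (hA0 : ∀ (K : ℕ) (t : ℝ), |t| ≤ l₀ → ∀ τ ∈ T K, 0 ≤ A K t τ)
    (hB0 : ∀ (K : ℕ) (t : ℝ), |t| ≤ l₀ → ∀ τ ∈ T K, 0 ≤ B K t τ) (hSh : ShellWeightBound l₀ T A B shA shB Wsh) :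
    (∃ Bad : ℕ → Finset ι, HybridNE7 l₀ vol T A B (fun K _ => Bad K) W shA shB Wsh δ) ↔
      (∀ K, 0 ≤ W K) ∧ (∀ K, W K + Wsh K < 1) ∧ Summable W ∧ Summable δ ∧
        ∀ K : ℕ, ∃ c : ℝ, ∀ t' : ℝ, |t'| ≤ l₀ →
          (∑ τ ∈ (T K).filter (fun τ => ∃ t : ℝ, |t| ≤ l₀ ∧ ¬ (Real.exp (c - vol * δ K) * (A K t τ - shA K t τ) ≤ B K t τ - shB K t τ ∧
              B K t τ - shB K t τ ≤ Real.exp (c + vol * δ K) * (A K t τ - shA K t τ))), A K t' τ ≤ W K * ∑ τ ∈ T K, A K t' τ) ∧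
          (∑ τ ∈ (T K).filter (fun τ => ∃ t : ℝ, |t| ≤ l₀ ∧ ¬ (Real.exp (c - vol * δ K) * (A K t τ - shA K t τ) ≤ B K t τ - shB K t τ ∧
              B K t τ - shB K t τ ≤ Real.exp (c + vol * δ K) * (A K t τ - shA K t τ))), B K t' τ ≤ W K * ∑ τ ∈ T K, B K t' τ) := by
  constructor
  · rintro ⟨Bad, h⟩
    have hW := h.weight
    refine ⟨hW.nonneg, h.lt_one, hW.summable, h.summable, fun K => ?_⟩
    obtain ⟨c, hc⟩ := h.core K
    refine ⟨c, fun t' ht' => ?_⟩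
    -- a class violating the sandwich at SOME admissible source lies in the (source-independent) bad class
    have hsub : ((T K).filter fun τ => ∃ t : ℝ, |t| ≤ l₀ ∧ ¬ (Real.exp (c - vol * δ K) * (A K t τ - shA K t τ) ≤ B K t τ - shB K t τ ∧
        B K t τ - shB K t τ ≤ Real.exp (c + vol * δ K) * (A K t τ - shA K t τ))) ⊆ Bad K := by
      intro τ hτ
      obtain ⟨hT, t, ht, hviol⟩ := Finset.mem_filter.mp hτ
      by_contra hB
      exact hviol (hc t ht τ (Finset.mem_sdiff.mpr ⟨hT, hB⟩))
    exact ⟨(Finset.sum_le_sum_of_subset_of_nonneg hsub fun τ hτ _ => hA0 K t' ht' τ (hW.bad_subset K t' ht' hτ)).trans (hW.bad_left K t' ht'),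
      (Finset.sum_le_sum_of_subset_of_nonneg hsub fun τ hτ _ => hB0 K t' ht' τ (hW.bad_subset K t' ht' hτ)).trans (hW.bad_right K t' ht')⟩
  · rintro ⟨hW0, hlt, hWs, hδ, hmass⟩
    choose c hc using hmass
    refine ⟨fun K => (T K).filter fun τ => ∃ t : ℝ, |t| ≤ l₀ ∧ ¬ (Real.exp (c K - vol * δ K) * (A K t τ - shA K t τ) ≤ B K t τ - shB K t τ ∧
        B K t τ - shB K t τ ≤ Real.exp (c K + vol * δ K) * (A K t τ - shA K t τ)), ?_⟩
    refine hybridNE7_of_relWeightBound ?_ hSh hlt hδ fun K => ⟨c K, fun t ht τ hτ => ?_⟩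
    · exact
        { bad_subset := fun _ _ _ => Finset.filter_subset _ _
          nonneg := hW0
          lt_one := fun K => by linarith [hlt K, hSh.nonneg K]
          summable := hWs
          bad_left := fun K t ht => (hc K t ht).1
          bad_right := fun K t ht => (hc K t ht).2 }
    · rw [Finset.mem_sdiff, Finset.mem_filter, not_and] at hτ
      have h := hτ.2 hτ.1
      by_contra hv
      exact h ⟨t, ht, hv⟩

end SourceIndependent

end Summit.QuantumFields.YangMills.BalabanUVNodes.N19DeviationFlagCanonical
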